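import Literature.Probability.LatticeModels.TorusZeroMode
import Literature.Barriers.CriticalPhenomena.PositionSpaceRGNonGibbsianIsraelLattice
import HarnessLib

/-!
# Israel's example (van Enter–Fernández–Sokal 1993, §4.1.2): the dedecorated lattice of centres
# and the inner (midpoint) system of the reduced model

Companion file of `PositionSpaceRGNonGibbsianIsraelLattice.lean`, second half of the bookkeeping for
the dedecoration of Steps 1–2 ("we can explicitly integrate out the spins in the decorated lattice
that have exactly two neighbors, yielding an effective coupling `J' = ½ log cosh 2J` between those
two neighbors. The result is an ordinary ferromagnetic Ising model on `ℤ²`", p. 94; "this last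
system is equivalent to a square lattice of size `(R+2) × (R+2)` with nearest-neighbor coupling
`J'` and `+` boundary conditions", p. 97):

* `oddGraph` — the nearest-neighbour graph of the rescaled lattice transported to the centres
  (`centerEmb x ∼ centerEmb y` iff `x ∼ y` in `ℤ²`), a local isomorphism along `centerEmb` in the
  sense of the tree's transport lemmas (`oddGraph_adj_centerEmb_iff`, `oddGraph_exists_of_adj`), so
  that `⟨σ_{centerEmb x}⟩⁺_{oddGraph; centres} = ⟨σ_x⟩⁺_{ℤ²; rescaled box}`
  (`isingExpect_plus_map_spinAt`);
* the bonds of the reduced graph `cutGraph n` at the midpoints: every bond meeting `W'_n` meets a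
  midpoint (`edgesTouching_cutGraph_internalVolume_subset`), no bond joins two midpoints
  (`anch_midFinset_eq_empty`), and the effective field felt by the midpoint `midOf (u,i)` from the
  non-midpoint spins is `σ_{centerEmb (u+eᵢ)} + σ_{centerEmb u}` (`frozenField_midOf`): "the spins …
  that have exactly two neighbors", the boundary midpoints seeing their outside centre frozen `+`.

All proved; no named facts.
-/

noncomputable section

namespace Literature.Barriers.CriticalPhenomena.NonGibbs

open Finset Literature.Probability.LatticeModels Literature.Probability.LatticeModels.AEdge

/-! ### The graph of centres -/

/-- Centre sites: both coordinates odd. [cite: VanenterFernandezSokal1993, §4.1.2 Step 1] -/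
def IsCenterSite (z : Site 2) : Prop := Odd (z 0) ∧ Odd (z 1)

/-- Decidability of being a centre. [cite: VanenterFernandezSokal1993, §4.1.2 Step 1] -/
instance : DecidablePred IsCenterSite := fun z => inferInstanceAs (Decidable (Odd (z 0) ∧ Odd (z 1)))

/-- Rescaled coordinates of a centre: `z ↦ (z - (1,1))/2`. [cite: VanenterFernandezSokal1993, §4.1.2 Step 1] -/
def halveOdd (z : Site 2) : Site 2 := fun k => (z k - 1) / 2

/-- `halveOdd (centerEmb x) = x`. [cite: VanenterFernandezSokal1993, §4.1.2 Step 1] -/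
@[simp] theorem halveOdd_centerEmb (x : Site 2) : halveOdd (centerEmb x) = x := by
  funext k; simp [halveOdd]

/-- A centre is `centerEmb` of its rescaled coordinates. [cite: VanenterFernandezSokal1993, §4.1.2 Step 1] -/
theorem centerEmb_halveOdd {z : Site 2} (hz : IsCenterSite z) : centerEmb (halveOdd z) = z := by
  funext k
  rw [centerEmb_apply, halveOdd]
  have : Odd (z k) := by fin_cases k <;> [exact hz.1; exact hz.2]
  obtain ⟨c, hc⟩ := this
  omega

/-- `centerEmb x` is a centre. [cite: VanenterFernandezSokal1993, §4.1.2 Step 1] -/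
theorem isCenterSite_centerEmb (x : Site 2) : IsCenterSite (centerEmb x) :=
  ⟨odd_centerEmb_apply x 0, odd_centerEmb_apply x 1⟩

/-- **The dedecorated lattice**: the graph on the centres obtained by transporting the
nearest-neighbour graph of `ℤ²` along `centerEmb` ("the equivalent nearest-neighbor interaction on
`(2ℤ)²`", Figure 3(c)); non-centres are isolated. [cite: VanenterFernandezSokal1993, §4.1.2 Step 1, Figure 3(c)] -/
def oddGraph : SimpleGraph (Site 2) where
  Adj x y := IsCenterSite x ∧ IsCenterSite y ∧ (zdGraph 2).Adj (halveOdd x) (halveOdd y)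
  symm := ⟨fun _ _ h => ⟨h.2.1, h.1, h.2.2.symm⟩⟩
  loopless := ⟨fun _ h => h.2.2.ne rfl⟩

/-- Adjacency in the dedecorated lattice. [cite: VanenterFernandezSokal1993, §4.1.2 Step 1, Figure 3(c)] -/
theorem oddGraph_adj_iff {x y : Site 2} :
    oddGraph.Adj x y ↔ IsCenterSite x ∧ IsCenterSite y ∧ (zdGraph 2).Adj (halveOdd x) (halveOdd y) :=
  Iff.rfl

/-- Decidability of adjacency. [cite: VanenterFernandezSokal1993, §4.1.2 Step 1] -/
instance : DecidableRel oddGraph.Adj := fun _ _ => inferInstanceAs (Decidable (_ ∧ _ ∧ _))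

/-- The dedecorated lattice is locally finite (neighbours of `z` are among the `centerEmb` of the
neighbours of `halveOdd z`), so the tree's finite-volume Ising model on it is available.
[cite: VanenterFernandezSokal1993, §4.1.2 Step 1] -/
instance : oddGraph.LocallyFinite := fun z =>
  Fintype.ofFinset ((((zdGraph 2).neighborFinset (halveOdd z)).image centerEmb).filter
    fun y => oddGraph.Adj z y) (by
    intro y
    simp only [Finset.mem_filter, Finset.mem_image, SimpleGraph.mem_neighborFinset,
      SimpleGraph.mem_neighborSet, and_iff_right_iff_imp]
    intro h
    exact ⟨halveOdd y, h.2.2, centerEmb_halveOdd h.2.1⟩)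

/-- **`centerEmb` is a local isomorphism**: `centerEmb x ∼ centerEmb y` iff `x ∼ y` (the hypothesis
`hadj` of the transport lemmas). [cite: VanenterFernandezSokal1993, §4.1.2 Step 1, Figure 3(c)] -/
theorem oddGraph_adj_centerEmb_iff (x y : Site 2) :
    oddGraph.Adj (centerEmb x) (centerEmb y) ↔ (zdGraph 2).Adj x y := by
  rw [oddGraph_adj_iff, halveOdd_centerEmb, halveOdd_centerEmb]
  exact ⟨fun h => h.2.2, fun h => ⟨isCenterSite_centerEmb x, isCenterSite_centerEmb y, h⟩⟩

/-- Every neighbour of a centre in the dedecorated lattice is a centre `centerEmb y` (the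
hypothesis `hnb` of the transport lemmas). [cite: VanenterFernandezSokal1993, §4.1.2 Step 1] -/
theorem oddGraph_exists_of_adj {x : Site 2} {y' : Site 2} (h : oddGraph.Adj (centerEmb x) y') :
    ∃ y, centerEmb y = y' :=
  ⟨halveOdd y', centerEmb_halveOdd h.2.1⟩

/-- **Transport of the `+` magnetisation to the rescaled lattice**:
`⟨σ_{centerEmb x}⟩⁺_{oddGraph; centerEmb(Λ); J', h} = ⟨σ_x⟩⁺_{ℤ²; Λ; J', h}` — the dedecorated system
on the centres of `Λ_{2n+2}` IS "a square lattice of size `(R+2) × (R+2)` … with `+` boundary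
conditions" (the tree's `isingExpect_plus_map_spinAt`).
[cite: VanenterFernandezSokal1993, §4.1.2 Step 2, Figure 4(e)] -/
theorem isingExpect_oddGraph_map_spinAt (Λ : Finset (Site 2)) (β h : ℝ) (x : Site 2) :
    isingExpect oddGraph (Λ.map centerEmb) β h .plus (spinAt (centerEmb x)) =
      isingExpect (zdGraph 2) Λ β h .plus (spinAt x) :=
  isingExpect_plus_map_spinAt centerEmb (fun x _ y => oddGraph_adj_centerEmb_iff x y)
    (fun _ _ _ hy => oddGraph_exists_of_adj hy) β h x

/-! ### The bonds of the reduced graph at the midpoints -/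

/-- The bonds of the reduced graph meeting a volume `Λ`, in anchored form (the general-volume form
of `edgesTouching_cutGraph_eq_image`). [cite: VanenterFernandezSokal1993, §4.1.2 Step 2, Figure 4(c)] -/
theorem edgesTouching_cutGraph_eq_image' (n : ℕ) (Λ : Finset (Site 2)) :
    edgesTouching (cutGraph n) Λ =
      ((anchT Λ).filter fun ε => ¬ IsCutSite n ε.1 ∧ ¬ IsCutSite n ε.tip).image toSym2 := by
  classical
  ext e
  rw [mem_edgesTouching_iff, Finset.mem_image]
  constructor
  · rintro ⟨he, x, hx, hxe⟩
    induction e using Sym2.ind with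
    | _ a b =>
      have hadj : (cutGraph n).Adj a b := by rwa [SimpleGraph.mem_edgeSet] at he
      obtain ⟨ε, hε⟩ := exists_of_adj hadj.1
      refine ⟨ε, Finset.mem_filter.2 ⟨mem_anchT.2 ?_, ?_⟩, hε⟩
      · rw [← hε, toSym2, Sym2.mem_iff] at hxe
        rcases hxe with rfl | rfl
        · exact Or.inl hx
        · exact Or.inr hx
      · have h1 : ε.1 = a ∨ ε.1 = b := by
          have : ε.1 ∈ s(a, b) := by rw [← hε, toSym2]; exact Sym2.mem_mk_left _ _
          exact Sym2.mem_iff.1 this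
        have h2 : ε.tip = a ∨ ε.tip = b := by
          have : ε.tip ∈ s(a, b) := by rw [← hε, toSym2]; exact Sym2.mem_mk_right _ _
          exact Sym2.mem_iff.1 this
        constructor
        · rcases h1 with h | h <;> rw [h]
          · exact hadj.2.1
          · exact hadj.2.2
        · rcases h2 with h | h <;> rw [h]
          · exact hadj.2.1
          · exact hadj.2.2
  · rintro ⟨ε, hε, rfl⟩
    rw [Finset.mem_filter, mem_anchT] at hε
    refine ⟨?_, ?_⟩
    · rw [toSym2, SimpleGraph.mem_edgeSet]
      exact ⟨ε.adj, hε.2.1, hε.2.2⟩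
    · rcases hε.1 with h | h
      · exact ⟨ε.1, h, Sym2.mem_mk_left _ _⟩
      · exact ⟨ε.tip, h, Sym2.mem_mk_right _ _⟩

/-- Midpoints are not cut. [cite: VanenterFernandezSokal1993, §4.1.2 Step 2] -/
theorem not_isCutSite_of_mem_midFinset {n : ℕ} {m : Site 2} (hm : m ∈ midFinset n) :
    ¬ IsCutSite n m :=
  not_isCutSite_of_mem_internalVolume (midFinset_subset n hm)

/-- Centres are not cut. [cite: VanenterFernandezSokal1993, §4.1.2 Step 2] -/
theorem not_isCutSite_centerEmb (n : ℕ) (x : Site 2) : ¬ IsCutSite n (centerEmb x) := fun h =>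
  not_isImageSite_centerEmb x h.2

/-- A neighbour `z = m ± eₖ` of a midpoint `m = midOf ε` is never a midpoint.
[cite: VanenterFernandezSokal1993, §4.1.2 Step 1] -/
theorem midOf_add_smul_vec_not_mem_midFinset (n : ℕ) (ε : AEdge) (k : Fin 2) {s : ℤ}
    (hs : s = 1 ∨ s = -1) : midOf ε + s • vec k ∉ midFinset n := by
  by_cases hk : k = ε.2
  · subst hk
    rw [midOf_add_smul_vec_same ε hs]
    exact centerEmb_not_mem_midFinset n _
  · intro hm
    obtain ⟨δ, -, hδ⟩ := mem_midFinset_iff.1 hm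
    -- parity: along `k` the site `midOf ε + s eₖ` is even, along `ε.2` it is even too
    have h1 : Even ((midOf ε + s • vec k) k) := by
      rw [nbr_apply_same]
      have hodd : Odd s := by rcases hs with rfl | rfl <;> decide
      exact (odd_midOf_apply_ne ε hk).add_odd hodd
    have h2 : Even ((midOf ε + s • vec k) ε.2) := by
      rw [nbr_apply_ne _ (Ne.symm hk)]
      exact even_midOf_apply_same ε
    -- but a midpoint has exactly one even coordinate
    rw [← hδ] at h1 h2
    by_cases hδ2 : δ.2 = k
    · have : Odd (midOf δ ε.2) := odd_midOf_apply_ne δ (by rw [hδ2]; exact Ne.symm hk)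
      exact Int.not_even_iff_odd.2 this h2
    · exact Int.not_even_iff_odd.2 (odd_midOf_apply_ne δ (Ne.symm hδ2)) h1

/-- **No bond of `ℤ²` joins two midpoints** (midpoints interact only with centres and, on layer
`Γ_{2n+2}`, with the outside): the anchored bonds inside `midFinset n` are empty.
[cite: VanenterFernandezSokal1993, §4.1.2 Step 1, Figure 3(b)] -/
theorem anch_midFinset_eq_empty (n : ℕ) : anch (midFinset n) = ∅ := by
  refine Finset.eq_empty_of_forall_notMem fun ε hε => ?_
  obtain ⟨h1, h2⟩ := mem_anch.1 hε
  obtain ⟨δ, -, hδ⟩ := mem_midFinset_iff.1 h1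
  have : ε.tip = midOf δ + (1 : ℤ) • vec ε.2 := by rw [one_smul, hδ]; rfl
  rw [this] at h2
  exact midOf_add_smul_vec_not_mem_midFinset n δ ε.2 (Or.inl rfl) h2

/-- **Every bond of the reduced graph meeting `W'_n` meets a midpoint** (a centre's four
neighbours are midpoints of the box), so the two-step decomposition of the Boltzmann sums over
`W'_n ⊇ midpoints` carries no extra factor. [cite: VanenterFernandezSokal1993, §4.1.2 Step 2] -/
theorem edgesTouching_cutGraph_internalVolume_subset (n : ℕ) :
    edgesTouching (cutGraph n) (internalVolume n) ⊆ edgesTouching (cutGraph n) (midFinset n) := by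
  intro e he
  rw [mem_edgesTouching_iff] at he ⊢
  obtain ⟨he, x, hx, hxe⟩ := he
  refine ⟨he, ?_⟩
  rcases exists_centerEmb_or_mem_midFinset hx with ⟨u, hu, rfl⟩ | hxm
  · -- the other endpoint of a bond at a centre is a midpoint of the box
    induction e using Sym2.ind with
    | _ a b =>
      have hadj : (cutGraph n).Adj a b := by rwa [SimpleGraph.mem_edgeSet] at he
      have key : ∀ {y : Site 2}, (zdGraph 2).Adj (centerEmb u) y → y ∈ midFinset n := by
        intro y hy
        obtain ⟨i, h | h⟩ := (zdGraph_adj_iff _ y).1 hy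
        · rw [h, show (Pi.single i (1 : ℤ) : Site 2) = (1 : ℤ) • vec i by simp [vec]]
          exact centerEmb_add_smul_vec_mem_midFinset hu i (Or.inl rfl)
        · have hy' : y = centerEmb u + (-1 : ℤ) • vec i := by
            rw [neg_one_smul, ← sub_eq_add_neg, eq_sub_iff_add_eq]; exact h.symm
          rw [hy']
          exact centerEmb_add_smul_vec_mem_midFinset hu i (Or.inr rfl)
      rcases Sym2.mem_iff.1 hxe with h0 | h0
      · exact ⟨b, key (h0 ▸ hadj.1), Sym2.mem_mk_right _ _⟩
      · exact ⟨a, key (h0 ▸ hadj.1.symm), Sym2.mem_mk_left _ _⟩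
  · exact ⟨x, hxm, hxe⟩

/-- **The effective field of a midpoint from the non-midpoint spins**: for a midpoint
`m = midOf (u, i)` of the box, the field `∑_{z ∼ m, z ∉ midpoints, z not cut} g z` is
`g(centerEmb (u + eᵢ)) + g(centerEmb u)` — its two centres (the second of which, for a midpoint of
layer `Γ_{2n+2}`, lies outside the box and is frozen `+` in the reduced system); the two neighbours
across the bond are cut image sites. [cite: VanenterFernandezSokal1993, §4.1.2 Steps 1–2, Figure 3(b)] -/
theorem frozenField_midOf {n : ℕ} {ε : AEdge} (hε : ε ∈ anchT (rescaledBox n)) (g : Site 2 → ℝ) :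
    frozenField (fun z => z ∈ midFinset n ∨ IsCutSite n z) g (midOf ε) =
      g (centerEmb ε.tip) + g (centerEmb ε.1) := by
  classical
  obtain ⟨j, hj⟩ := exists_fin_two_ne ε.2
  unfold frozenField
  rw [sum_fin_two_eq_of_ne (Ne.symm hj)]
  -- along the bond: the two centres, neither midpoints nor cut
  have hp : ¬ (midOf ε + vec ε.2 ∈ midFinset n ∨ IsCutSite n (midOf ε + vec ε.2)) := by
    rw [midOf_add_vec]
    exact not_or.2 ⟨centerEmb_not_mem_midFinset n _, not_isCutSite_centerEmb n _⟩
  have hm : ¬ (midOf ε - vec ε.2 ∈ midFinset n ∨ IsCutSite n (midOf ε - vec ε.2)) := by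
    rw [midOf_sub_vec]
    exact not_or.2 ⟨centerEmb_not_mem_midFinset n _, not_isCutSite_centerEmb n _⟩
  -- across the bond: cut image sites
  have hpj : midOf ε + vec j ∈ midFinset n ∨ IsCutSite n (midOf ε + vec j) := by
    right
    have := isCutSite_midOf_add_smul_vec_ne hε hj (s := 1) (Or.inl rfl)
    rwa [one_smul] at this
  have hmj : midOf ε - vec j ∈ midFinset n ∨ IsCutSite n (midOf ε - vec j) := by
    right
    have := isCutSite_midOf_add_smul_vec_ne hε hj (s := -1) (Or.inr rfl)
    rwa [neg_one_smul, ← sub_eq_add_neg] at this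
  rw [if_neg hp, if_neg hm, if_pos hpj, if_pos hmj, midOf_add_vec, midOf_sub_vec]
  ring

end Literature.Barriers.CriticalPhenomena.NonGibbs

end
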